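import Summits.Parity.GeneralizedHardyLittlewood.Theorems.BeyondDiagonalBeatsQuarter.OffDiagDualBoxLedgerScaled
import Summits.Parity.GeneralizedHardyLittlewood.Theorems.BeyondDiagonalBeatsQuarter.OffDiagDualLedgerTools
import HarnessLib

/-!
# Route `PrimeLevelFamEdge`, crux K_B (stmt-Parity-20343), line `diagonal_kernel_split` rev 4, plan Ω,
# worker key L3 (part 6d, row) `OffDiagDualLedgerRow`: the per-box trivial ledger made UNIFORM in the box —
# for a near box `i` of the layer piece `(d₁, d₂, r)` of `offDiag q l m` (`l, m ≤ M < q`, `r ≤ R`):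
# `Σ_{box} ‖Φ̂_i(h/(qr))‖·N ≤ ledgerRow(q,M,R,y₀,Λ,Q,δ,C) · gcd(l/d₁, r) · √(lm) · r⁻¹`

From L3 part 6c (`sum_dualBox_norm_le_of_truncation`) by the crude but exponent-preserving simplifications
`W ≤ 1`, `√(αβ)(d₁d₂)^{−1/2} ≤ √(lm)` (`α = l/d₁ ≤ l`, `β = m/d₂ ≤ m`), `Z ≤ Z_b := 4π√(M²·4q̂²y₀)/q` (near box:
`K₁K₂ < 4q̂²y₀`, `qr ≥ q`, `lm ≤ M²`), `(1+Z)^{−3/2} ≤ 1`, `K₁K₂(1+Z)^{−3/2}/(qr) ≤ 4q̂²y₀/q`, `(qr)² ≤ (qR)²`,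
`gcd(l/d₁, qr) = gcd(l/d₁, r)` (prime level). Definitions (bookkeeping abbreviations of this line, reviewed):
`ledgerZ q M y₀ = 4π√(M²·4q̂²y₀)/q` and
`ledgerRow q M R y₀ Λ Q δ C = 2520π·2C·(Λ(qR)²(1+Z_b)²Q²)^δ·(2ΛQ²(1+Z_b)^{1/2} + 4q̂²y₀/q)`.
At `M = q̂^{Δ′}`, `y₀ = (log q)⁴`, `R = q⁷`: `Z_b ≍ q̂^{η}L²` and `ledgerRow ≍ ΛQ²q^{O(δ)}·q̂^{η/2}L` — the source of the
`1/4` in `κ₀ = 5/4` once summed against `|c_lc_m|√(lm)` (`Σ ≍ M²`) and the prefactor `4πq̂/q`.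
Absolute values only; nothing about the heart. Helper (`--supports stmt-Parity-20343`); standard axioms.
«The programme SEARCHES and TYPES; no claim about Landau–Siegel zeros, Theorems 1–2 of arXiv:2211.02515 or
a repaired Margin232 until a kernel theorem says so.»
-/

noncomputable section

open Finset
open scoped Real

namespace Summit.Parity.GeneralizedHardyLittlewood.Theorems.BeyondDiagonalBeatsQuarter.OffDiag

open Literature.NumberTheory.LFunctions Literature.NumberTheory.LFunctions.KMV2000
open Literature.Analysis.FunctionSpaces (besselJ)
open Literature.NumberTheory.Sieve.FriedlanderIwaniecPrimes (fourier2)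
open OffDiagDual (one_le_div_of_dvd)

/-- The uniform Bessel scale of the ledger: `Z_b(q,M,y₀) = 4π√(M²·4q̂²y₀)/q` (`≥ Z` on every near box of every
layer of `offDiag q l m`, `l, m ≤ M`). A bookkeeping abbreviation. [cite: KowalskiMichelVanderKam2000, (21)–(23) p. 12 — derivation] -/
def ledgerZ (q : ℕ) (M y₀ : ℝ) : ℝ :=
  4 * π * Real.sqrt (M ^ 2 * (4 * qhat q ^ 2 * y₀)) / q

/-- The uniform row constant of the trivial ledger:
`ledgerRow q M R y₀ Λ Q δ C = 2520π·2C·(Λ((qR)²(1+Z_b)²Q²))^δ·(2ΛQ²(1+Z_b)^{1/2} + 4q̂²y₀/q)`. A bookkeeping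
abbreviation. [cite: KowalskiMichelVanderKam2000, (21)–(23) p. 12 — derivation] -/
def ledgerRow (q : ℕ) (M R y₀ Λ Q δ C : ℝ) : ℝ :=
  2520 * π * (2 * C * (Λ * (((q : ℝ) * R) ^ 2 * (1 + ledgerZ q M y₀) ^ 2 * Q ^ 2)) ^ δ) *
    (2 * Λ * Q ^ 2 * (1 + ledgerZ q M y₀) ^ (1 / 2 : ℝ) + 4 * qhat q ^ 2 * y₀ / q)

/-- `ledgerZ ≥ 0`. -/
theorem ledgerZ_nonneg (q : ℕ) (M y₀ : ℝ) : 0 ≤ ledgerZ q M y₀ := by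
  unfold ledgerZ; positivity

/-- `ledgerRow ≥ 0` for `C, Λ, y₀ ≥ 0`. -/
theorem ledgerRow_nonneg (q : ℕ) {M R y₀ Λ Q δ C : ℝ} (hC : 0 ≤ C) (hΛ : 0 ≤ Λ) (hy : 0 ≤ y₀) :
    0 ≤ ledgerRow q M R y₀ Λ Q δ C := by
  have := ledgerZ_nonneg q M y₀
  unfold ledgerRow; positivity

variable {q : ℕ}

/-- On a near box of a layer of `offDiag q l m` the Bessel scale is at most `Z_b`:
`4π√(αβK₁K₂)/(qr) ≤ 4π√(M²·4q̂²y₀)/q` for `αβ ≤ M²`, `K₁K₂ ≤ 4q̂²y₀`, `r ≥ 1`. [folklore] -/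
theorem Z_le_ledgerZ (hq : 1 ≤ q) {α β r : ℕ} (hr : 1 ≤ r) {M y₀ K : ℝ} (hK0 : 0 ≤ K)
    (hαβ : (α : ℝ) * β ≤ M ^ 2) (hK : K ≤ 4 * qhat q ^ 2 * y₀) :
    4 * π * Real.sqrt ((α : ℝ) * (β : ℝ) * K) / ((q : ℝ) * r) ≤ ledgerZ q M y₀ := by
  have hq0 : (0 : ℝ) < q := by exact_mod_cast hq
  have hr1 : (1 : ℝ) ≤ r := by exact_mod_cast hr
  unfold ledgerZ
  have hs : Real.sqrt ((α : ℝ) * (β : ℝ) * K) ≤ Real.sqrt (M ^ 2 * (4 * qhat q ^ 2 * y₀)) :=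
    Real.sqrt_le_sqrt (mul_le_mul hαβ hK hK0 (by positivity))
  calc 4 * π * Real.sqrt ((α : ℝ) * (β : ℝ) * K) / ((q : ℝ) * r)
      ≤ 4 * π * Real.sqrt ((α : ℝ) * (β : ℝ) * K) / ((q : ℝ) * 1) := by
        refine div_le_div_of_nonneg_left (by positivity) (by positivity) ?_
        exact mul_le_mul_of_nonneg_left hr1 hq0.le
    _ ≤ 4 * π * Real.sqrt (M ^ 2 * (4 * qhat q ^ 2 * y₀)) / q := by
        rw [mul_one]; gcongr

/-- **The uniform row.** Let `q` be prime, `1 ≤ M < q`, `l, m ∈ [1, M]`, `d₁ ∣ l`, `d₂ ∣ m`, `1 ≤ r ≤ R`,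
`y₀ > 0`, `i ∈ nearBoxes q d₁ d₂ y₀`, `Λ ≥ 0`, `δ ≥ 0`, the divisor bound `τ(n) ≤ Cn^δ`, and a dual box with
`A₁A₂ ≤ Λ(qr)²(1+Z)²Q²/(K₁K₂)` (`α = l/d₁`, `β = m/d₂`). Then
`Σ_{(h₁,h₂) ∈ [-A₁,A₁]×[-A₂,A₂]} ‖Φ̂_i(h/(qr))‖·N_{qr}(l/d₁,m/d₂;h) ≤ ledgerRow(q,M,R,y₀,Λ,Q,δ,C)·gcd(l/d₁,r)·√(lm)·r⁻¹`.
[cite: KowalskiMichelVanderKam2000, (21)–(23) p. 12 and Lemma 3.3 p. 9 — derivation] -/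
theorem sum_dualBox_norm_le_row [NeZero q] (hq : q.Prime) {M : ℝ} (hMq : M < q) {l m : ℕ}
    (hl : l ∈ Finset.Icc 1 ⌊M⌋₊) (hm : m ∈ Finset.Icc 1 ⌊M⌋₊) {d₁ d₂ : ℕ} (hd₁ : d₁ ∈ l.divisors)
    (hd₂ : d₂ ∈ m.divisors) {r : ℕ} (hr : 1 ≤ r) {R : ℝ} (hrR : (r : ℝ) ≤ R) [NeZero (q * r)] {y₀ : ℝ}
    (hy₀ : 0 < y₀) {i : ℕ × ℕ} (hi : i ∈ PeterssonSplit.nearBoxes q d₁ d₂ y₀) {Λ Q δ C : ℝ} (hΛ : 0 ≤ Λ)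
    (hδ : 0 ≤ δ) (hC : ∀ n : ℕ, ((n.divisors.card : ℕ) : ℝ) ≤ C * (n : ℝ) ^ δ) {A₁ A₂ : ℕ}
    (hA : (A₁ : ℝ) * A₂ ≤ Λ * (((q : ℝ) * r) ^ 2 *
      (1 + 4 * π * Real.sqrt (((l / d₁ : ℕ) : ℝ) * ((m / d₂ : ℕ) : ℝ) * ((2 : ℝ) ^ i.1 * 2 ^ i.2)) /
        ((q : ℝ) * r)) ^ 2 * Q ^ 2 / ((2 : ℝ) ^ i.1 * 2 ^ i.2))) :
    ∑ h ∈ (Finset.Icc (-(A₁ : ℤ)) A₁) ×ˢ (Finset.Icc (-(A₂ : ℤ)) A₂),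
        ‖fourier2 (boxWeight q d₁ d₂ (l / d₁) (m / d₂) r i) (h.1 / (q * r : ℕ)) (h.2 / (q * r : ℕ))‖ *
          (dualCount (q * r) ((l / d₁ : ℕ) : ZMod (q * r)) ((m / d₂ : ℕ) : ZMod (q * r))
            (h.1 : ZMod (q * r)) (h.2 : ZMod (q * r)) : ℝ) ≤
      ledgerRow q M R y₀ Λ Q δ C * (Nat.gcd (l / d₁) r : ℝ) * Real.sqrt ((l : ℝ) * m) * (r : ℝ)⁻¹ := by
  -- integer facts
  obtain ⟨hl1, hlM⟩ := Finset.mem_Icc.1 hl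
  obtain ⟨hm1, hmM⟩ := Finset.mem_Icc.1 hm
  have hM0 : 0 ≤ M := le_trans zero_le_one (le_trans (by exact_mod_cast hl1) (le_trans
    (by exact_mod_cast hlM : ((l : ℕ) : ℝ) ≤ ⌊M⌋₊) (Nat.floor_le (by
      by_contra h; push Not at h; have := Nat.floor_of_nonpos h.le; rw [this] at hlM; omega))))
  have hlMr : (l : ℝ) ≤ M := (Nat.cast_le.2 hlM).trans (Nat.floor_le hM0)
  have hmMr : (m : ℝ) ≤ M := (Nat.cast_le.2 hmM).trans (Nat.floor_le hM0)
  have hlq : l < q := by exact_mod_cast hlMr.trans_lt hMq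
  have hmq : m < q := by exact_mod_cast hmMr.trans_lt hMq
  have hd₁1 : 1 ≤ d₁ := Nat.pos_of_mem_divisors hd₁
  have hd₂1 : 1 ≤ d₂ := Nat.pos_of_mem_divisors hd₂
  have hα : 1 ≤ l / d₁ := one_le_div_of_dvd (Nat.dvd_of_mem_divisors hd₁) hl1
  have hβ : 1 ≤ m / d₂ := one_le_div_of_dvd (Nat.dvd_of_mem_divisors hd₂) hm1
  have hαl : l / d₁ ≤ l := Nat.div_le_self _ _
  have hβm : m / d₂ ≤ m := Nat.div_le_self _ _
  have hndvd : ¬ q * r ∣ (l / d₁) * (m / d₂) :=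
    not_mul_dvd_mul_primeLevel hq hα (lt_of_le_of_lt hαl hlq) hβ (lt_of_le_of_lt hβm hmq) r
  have hq1 : 1 ≤ q := hq.one_lt.le
  have hq0 : (0 : ℝ) < q := by exact_mod_cast hq.pos
  have hr0 : (0 : ℝ) < r := by exact_mod_cast hr
  have hQ : 0 < qhat q := qhat_pos hq1
  have hC0 : 0 ≤ C := by
    have h := hC 1
    simp at h
    linarith
  -- the per-box closed form
  have hbox := sum_dualBox_norm_le_of_truncation (q := q) (Q := Q) hd₁1 hd₂1 hα hβ hr hndvd i hδ hC hΛ hA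
  -- the factor-by-factor bounds
  set K : ℝ := (2 : ℝ) ^ i.1 * 2 ^ i.2 with hK
  have hK0 : 0 < K := by positivity
  set Z : ℝ := 4 * π * Real.sqrt (((l / d₁ : ℕ) : ℝ) * ((m / d₂ : ℕ) : ℝ) * K) / ((q : ℝ) * r) with hZ
  have hZ0 : 0 ≤ Z := by positivity
  have h1Z : 1 ≤ 1 + Z := by linarith
  -- near box: `K·d₁d₂ < 4q̂²y₀`, so `K ≤ 4q̂²y₀`
  have hnear := PeterssonSplit.not_far_of_mem_nearBoxes hi
  rw [not_le] at hnear
  have hKy : K ≤ 4 * qhat q ^ 2 * y₀ := by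
    have hd : (1 : ℝ) ≤ (d₁ : ℝ) * d₂ := by exact_mod_cast Nat.mul_le_mul hd₁1 hd₂1
    have : (2 : ℝ) ^ (i.1 + i.2) ≤ 2 ^ (i.1 + i.2) * ((d₁ : ℝ) * d₂) := le_mul_of_one_le_right (by positivity) hd
    rw [hK, ← pow_add]; linarith
  have hαβ : (((l / d₁ : ℕ) : ℝ)) * ((m / d₂ : ℕ) : ℝ) ≤ M ^ 2 := by
    have h1 : (((l / d₁ : ℕ) : ℝ)) ≤ M := le_trans (by exact_mod_cast hαl) hlMr
    have h2 : (((m / d₂ : ℕ) : ℝ)) ≤ M := le_trans (by exact_mod_cast hβm) hmMr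
    calc (((l / d₁ : ℕ) : ℝ)) * ((m / d₂ : ℕ) : ℝ) ≤ M * M := mul_le_mul h1 h2 (by positivity) hM0
      _ = M ^ 2 := by ring
  have hZb : Z ≤ ledgerZ q M y₀ := Z_le_ledgerZ hq1 hr hK0.le hαβ hKy
  have hZb0 := ledgerZ_nonneg q M y₀
  -- (a) gcd at prime level
  have hg : (Nat.gcd (l / d₁) (q * r) : ℝ) = (Nat.gcd (l / d₁) r : ℝ) := by
    rw [gcd_mul_primeLevel hq hα (lt_of_le_of_lt hαl hlq) r]
  -- (b) `P^δ ≤ Pb^δ`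
  have hP : Λ * (((q : ℝ) * r) ^ 2 * (1 + Z) ^ 2 * Q ^ 2) ≤
      Λ * (((q : ℝ) * R) ^ 2 * (1 + ledgerZ q M y₀) ^ 2 * Q ^ 2) := by
    refine mul_le_mul_of_nonneg_left ?_ hΛ
    have h1 : ((q : ℝ) * r) ^ 2 ≤ ((q : ℝ) * R) ^ 2 :=
      pow_le_pow_left₀ (by positivity) (mul_le_mul_of_nonneg_left hrR hq0.le) 2
    have h2 : (1 + Z) ^ 2 ≤ (1 + ledgerZ q M y₀) ^ 2 := pow_le_pow_left₀ (by positivity) (by linarith) 2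
    exact mul_le_mul (mul_le_mul h1 h2 (by positivity) (by positivity)) le_rfl (by positivity) (by positivity)
  have hPδ : (Λ * (((q : ℝ) * r) ^ 2 * (1 + Z) ^ 2 * Q ^ 2)) ^ δ ≤
      (Λ * (((q : ℝ) * R) ^ 2 * (1 + ledgerZ q M y₀) ^ 2 * Q ^ 2)) ^ δ :=
    Real.rpow_le_rpow (by positivity) hP hδ
  -- (c) `W ≤ 1`
  have hW : cutoffW ((d₁ : ℝ) * d₂ * K / 4 / qhat q ^ 2) ≤ 1 := cutoffW_le_one (by positivity)
  have hW0 : 0 ≤ cutoffW ((d₁ : ℝ) * d₂ * K / 4 / qhat q ^ 2) := cutoffW_nonneg _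
  -- (d) `√(αβ)(d₁d₂)^{-1/2} ≤ √(lm)`
  have hs : Real.sqrt ((((l / d₁ : ℕ) : ℝ)) * ((m / d₂ : ℕ) : ℝ)) * ((d₁ : ℝ) * d₂) ^ (-(1 / 2 : ℝ)) ≤
      Real.sqrt ((l : ℝ) * m) := by
    have h1 : Real.sqrt ((((l / d₁ : ℕ) : ℝ)) * ((m / d₂ : ℕ) : ℝ)) ≤ Real.sqrt ((l : ℝ) * m) :=
      Real.sqrt_le_sqrt (mul_le_mul (by exact_mod_cast hαl) (by exact_mod_cast hβm) (by positivity)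
        (by positivity))
    have h2 : ((d₁ : ℝ) * d₂) ^ (-(1 / 2 : ℝ)) ≤ 1 :=
      Real.rpow_le_one_of_one_le_of_nonpos (by exact_mod_cast Nat.mul_le_mul hd₁1 hd₂1) (by norm_num)
    calc _ ≤ Real.sqrt ((l : ℝ) * m) * 1 := mul_le_mul h1 h2 (by positivity) (Real.sqrt_nonneg _)
      _ = _ := mul_one _
  -- (e) the bracket
  have hbr : 2 * Λ * Q ^ 2 * (1 + Z) ^ (1 / 2 : ℝ) + K * (1 + Z) ^ (-(3 / 2 : ℝ)) / ((q : ℝ) * r) ≤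
      2 * Λ * Q ^ 2 * (1 + ledgerZ q M y₀) ^ (1 / 2 : ℝ) + 4 * qhat q ^ 2 * y₀ / q := by
    have h1 : (1 + Z) ^ (1 / 2 : ℝ) ≤ (1 + ledgerZ q M y₀) ^ (1 / 2 : ℝ) :=
      Real.rpow_le_rpow (by positivity) (by linarith) (by norm_num)
    have h2 : (1 + Z) ^ (-(3 / 2 : ℝ)) ≤ 1 := Real.rpow_le_one_of_one_le_of_nonpos h1Z (by norm_num)
    have h3 : K * (1 + Z) ^ (-(3 / 2 : ℝ)) / ((q : ℝ) * r) ≤ 4 * qhat q ^ 2 * y₀ / q := by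
      have hnum : K * (1 + Z) ^ (-(3 / 2 : ℝ)) ≤ 4 * qhat q ^ 2 * y₀ := by
        calc K * (1 + Z) ^ (-(3 / 2 : ℝ)) ≤ K * 1 := mul_le_mul_of_nonneg_left h2 hK0.le
          _ ≤ 4 * qhat q ^ 2 * y₀ := by rw [mul_one]; exact hKy
      have hden : (q : ℝ) ≤ (q : ℝ) * r := le_mul_of_one_le_right hq0.le (by exact_mod_cast hr)
      calc K * (1 + Z) ^ (-(3 / 2 : ℝ)) / ((q : ℝ) * r) ≤ 4 * qhat q ^ 2 * y₀ / ((q : ℝ) * r) :=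
            div_le_div_of_nonneg_right hnum (by positivity)
        _ ≤ 4 * qhat q ^ 2 * y₀ / q := div_le_div_of_nonneg_left (by positivity) hq0 hden
    have h4 : 2 * Λ * Q ^ 2 * (1 + Z) ^ (1 / 2 : ℝ) ≤ 2 * Λ * Q ^ 2 * (1 + ledgerZ q M y₀) ^ (1 / 2 : ℝ) :=
      mul_le_mul_of_nonneg_left h1 (by positivity)
    linarith
  -- assemble
  refine hbox.trans ?_
  rw [hg]
  unfold ledgerRow
  have hgcd0 : (0 : ℝ) ≤ (Nat.gcd (l / d₁) r : ℝ) := Nat.cast_nonneg _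
  have hbr0 : 0 ≤ 2 * Λ * Q ^ 2 * (1 + Z) ^ (1 / 2 : ℝ) + K * (1 + Z) ^ (-(3 / 2 : ℝ)) / ((q : ℝ) * r) := by
    positivity
  calc 2520 * π * (Nat.gcd (l / d₁) r : ℝ) *
        (2 * C * (Λ * (((q : ℝ) * r) ^ 2 * (1 + Z) ^ 2 * Q ^ 2)) ^ δ) *
        cutoffW ((d₁ : ℝ) * d₂ * K / 4 / qhat q ^ 2) *
        (Real.sqrt ((((l / d₁ : ℕ) : ℝ)) * ((m / d₂ : ℕ) : ℝ)) * ((d₁ : ℝ) * d₂) ^ (-(1 / 2 : ℝ)) * (r : ℝ)⁻¹) *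
        (2 * Λ * Q ^ 2 * (1 + Z) ^ (1 / 2 : ℝ) + K * (1 + Z) ^ (-(3 / 2 : ℝ)) / ((q : ℝ) * r))
      ≤ 2520 * π * (Nat.gcd (l / d₁) r : ℝ) *
        (2 * C * (Λ * (((q : ℝ) * R) ^ 2 * (1 + ledgerZ q M y₀) ^ 2 * Q ^ 2)) ^ δ) * 1 *
        (Real.sqrt ((l : ℝ) * m) * (r : ℝ)⁻¹) *
        (2 * Λ * Q ^ 2 * (1 + ledgerZ q M y₀) ^ (1 / 2 : ℝ) + 4 * qhat q ^ 2 * y₀ / q) := by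
        have e1 : Real.sqrt ((((l / d₁ : ℕ) : ℝ)) * ((m / d₂ : ℕ) : ℝ)) * ((d₁ : ℝ) * d₂) ^ (-(1 / 2 : ℝ)) *
            (r : ℝ)⁻¹ ≤ Real.sqrt ((l : ℝ) * m) * (r : ℝ)⁻¹ :=
          mul_le_mul_of_nonneg_right hs (by positivity)
        gcongr
    _ = _ := by ring

end Summit.Parity.GeneralizedHardyLittlewood.Theorems.BeyondDiagonalBeatsQuarter.OffDiag
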